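import Summits.BirchSwinnertonDyer.BirchSwinnertonDyer.Theorems.UniversalToricDescentDefectTransportModThreePTOfSigmaCongruence
import Summits.BirchSwinnertonDyer.BirchSwinnertonDyer.Theorems.UniversalToricDescentTorsionMuTransportHeegner
import Summits.BirchSwinnertonDyer.BirchSwinnertonDyer.Theorems.SchneiderFreeAdditiveX3PoitouTateSelmerDualityHolds
import Summits.BirchSwinnertonDyer.BirchSwinnertonDyer.Theorems.UniversalToricDescentPoitouTateShaTateDualFact
import HarnessLib

/-!
# Crux ♭T≤ `DefectTransportModThreePT` (stmt-BirchSwinnertonDyer-23042) WALL-FREE (LEAD utd-p1 g19, p705467) AND keyed on the ONE-SIDED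
# invariant pair A≤ instead of A = `SigmaCongruenceAtThree` (stmt-BirchSwinnertonDyer-27120)

Width prover bsd-wall-utd-p1-w2 g5 (`--supports stmt-BirchSwinnertonDyer-20186`, helper). The LEAD's wall-free forms
(`UniversalToricDescentDefectTransportModThreePTWallFree.defectTransportPT_of_mu_of_sigmaCongruence` / `_wallFree_` / `_of_twinIMC`, p705467)
take `hA : SigmaCongruenceAtThree` and use it ONCE — for the analytic identity `m + Σ = m′ + Σ′` at B′≤'s data, of which the closing
cancellation needs only `m + Σ ≤ m′ + Σ′` (this seat's reading, `UniversalToricDescentDefectTransportModThreePTOfLambdaLe`, p706556).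
This file re-keys the three wall-free forms on the weaker ONE-SIDED hypothesis A≤ = «A's binders verbatim → `∃ m m′`, `𝓛` has norm
profile `m`, `𝓛′` has norm profile `m′`, `m + Σ_{v∈T} 3^{c_v}·d_v(E_K) ≤ m′ + Σ_{v∈T} 3^{c_v}·d_v(E′_K)`» (`λ(𝓛^Σ_E) ≤ λ(𝓛^Σ_{E′})`;
A ⟹ A≤ is `…OfLambdaLe.lambdaLe_of_sigmaCongruenceAtThree`), so that the pen's rational road (RK-6 v2: kernel_rat keyed on A, rational
wall, twin IMC, `torsionMuTransportModThree`) can be keyed on A≤ with no other change: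

* `defectTransportPT_of_mu_of_lambdaLe` — ♭T≤'s conclusion from A≤, `Λ`-torsion of `X_{∅,0}(E/K_∞)` and a `μ = 0` generator of
  `Ch·R₀⟦T⟧` in place of the wall (proof = the LEAD's, last step `d_v = s_v` + `omega` on the inequality);
* `defectTransportPT_wallFree_of_lambdaLe` — the same from the TWIN's torsion + `μ = 0` generator (`torsionMuTransportModThree`, GV 2.8);
* `defectTransportPT_wallFree_of_lambdaLe_of_twinIMC` — twin input as `Ch(E′)·R₀⟦T⟧ = (𝓛′)`.

THEOREMS ONLY; no definition, no named fact, no `sorry`; Poitou–Tate antecedents discharged by name as in the LEAD's file. Nothing here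
claims A≤; BSD is not proved by any of this. References: [GreenbergVatsal2000] Thm. (1.4), (1.5), §2 Prop. (2.4), (2.8);
[LeiMullerXia2023] Cor. 3.8, Thm. 5.1.
-/

noncomputable section

open scoped Classical

set_option linter.dupNamespace false
set_option autoImplicit false

namespace Summit.BirchSwinnertonDyer.BirchSwinnertonDyer.Theorems.UniversalToricDescentDefectTransportModThreePTWallFreeOfLambdaLe

open PowerSeries WeierstrassCurve NumberField IsDedekindDomain Field Polynomial
  Literature.NumberTheory.EllipticCurves
  Literature.NumberTheory.EllipticCurves.ModularForms
  Literature.NumberTheory.EllipticCurves.Rank1Residual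
  Literature.NumberTheory.EllipticCurves.GreenbergSelmer
  Literature.NumberTheory.EllipticCurves.GreenbergVatsal2000
  Literature.NumberTheory.EllipticCurves.IwasawaAlgebra
  Literature.NumberTheory.GaloisRepresentations Literature.NumberTheory.GaloisCohomology
  Summit.BirchSwinnertonDyer.Rank1Residual Summit.BirchSwinnertonDyer.Rank1Residual.X11b
  Summit.BirchSwinnertonDyer.Rank1Residual.X11b.AcSelmer Summit.BirchSwinnertonDyer.Rank1Residual.X11b.Coinv
  Summit.BirchSwinnertonDyer.Rank1Residual.Iwasawa
  Summit.BirchSwinnertonDyer.BirchSwinnertonDyer.Theorems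
  Summit.BirchSwinnertonDyer.BirchSwinnertonDyer.Theorems.SchneiderFree
  Summit.BirchSwinnertonDyer.BirchSwinnertonDyer.Theorems.UniversalToricDescentDefectTransport
  Summit.BirchSwinnertonDyer.BirchSwinnertonDyer.Theorems.UniversalToricDescentNormProfile
  Summit.BirchSwinnertonDyer.BirchSwinnertonDyer.Theorems.UniversalToricDescentAcEulerFactor
  Summit.BirchSwinnertonDyer.BirchSwinnertonDyer.Theorems.UniversalToricDescentSigmaLocalStabilizer
  Summit.BirchSwinnertonDyer.BirchSwinnertonDyer.Theorems.UniversalToricDescentDefectTransportModThreePTOfSigmaCongruence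
  Summit.BirchSwinnertonDyer.BirchSwinnertonDyer.Theses.UniversalToricDescent

/-- **♭T≤ from `μ(X_E) = 0` and the ONE-SIDED invariant pair A≤** (primitive wall-free form; = the LEAD's
`defectTransportPT_of_mu_of_sigmaCongruence` with `hA` weakened to A≤): ♭T≤'s conclusion from A≤, `Λ`-torsion of `X := X_{∅,0}(E/K_∞)`
and a generator of `Ch_Λ(X)·R₀⟦T⟧` with a norm-one coefficient in place of the wall; `oneSidedTransport` (p698423) at that generator,
A≤ at its data `(T, c)`, `d_v = s_v` (`natCard_pTorsion_subgroupH1_kerD_eq_pow_rootMultiplicity`), `omega`.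
[cite: GreenbergVatsal2000, Thm. (1.4), (1.5), §2 Prop. (2.1), Cor. (2.3), Prop. (2.4)] [cite: LeiMullerXia2023, Cor. 3.8] -/
theorem defectTransportPT_of_mu_of_lambdaLe
    (hAle :
      ∀ (W : WeierstrassCurve ℚ) [W.IsElliptic] [W.IsGloballyMinimal] (W' : WeierstrassCurve ℚ) [W'.IsElliptic]
      [W'.IsGloballyMinimal] (N N' : ℕ) [NeZero N] [NeZero N'] (K : Type) [Field K] [NumberField K] (Dt :
      Literature.NumberTheory.EllipticCurves.ModularForms.ModularParametrizationData W N) (Dt' :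
      Literature.NumberTheory.EllipticCurves.ModularForms.ModularParametrizationData W' N'),
      Summit.BirchSwinnertonDyer.Rank1Residual.Additive.ClassO6 W 3 → W.HasSurjectiveModNGaloisRep 3 →
      W.analyticRank = 1 → W.conductorNorm ℤ = N → Summit.BirchSwinnertonDyer.Rank1Residual.O6.ModPCongruent W' W
      3 → ¬ Literature.NumberTheory.EllipticCurves.Rank1Residual.Addv W' 3 → W'.conductorNorm ℤ = N' →
      Literature.NumberTheory.EllipticCurves.IsImaginaryQuadratic K →
      Literature.NumberTheory.EllipticCurves.SatisfiesHeegnerHypothesis N K →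
      Literature.NumberTheory.EllipticCurves.SatisfiesHeegnerHypothesis N' K → ∀ (κ :
      Literature.NumberTheory.EllipticCurves.ZpExtension K 3), κ.IsAnticyclotomic → ∀ (γ :
      Field.absoluteGaloisGroup K) [Fact (κ.IsTopGenerator γ)] (𝔭 : IsDedekindDomain.HeightOneSpectrum
      (NumberField.RingOfIntegers K)), ((3 : ℕ) : NumberField.RingOfIntegers K) ∈ 𝔭.asIdeal →
      𝔭.asIdeal.ramificationIdx (NumberField.RingOfIntegers ℚ) = 1 → 𝔭.asIdeal.inertiaDeg
      (NumberField.RingOfIntegers ℚ) = 1 → ∀ (𝔭' : IsDedekindDomain.HeightOneSpectrum (NumberField.RingOfIntegers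
      K)), ((3 : ℕ) : NumberField.RingOfIntegers K) ∈ 𝔭'.asIdeal → 𝔭' ≠ 𝔭 → ∀ (ι' : PadicAlgCl 3 ≃+* ℂ),
      Summit.BirchSwinnertonDyer.BirchSwinnertonDyer.Theorems.SchneiderFree.BranchInducesPrime 3 ι' 𝔭 → ∀ (ΩK : ℂ)
      (Ωp : ℂ_[3]) (L : Literature.NumberTheory.EllipticCurves.UnrSeries 3), ΩK ≠ 0 → Ωp ≠ 0 →
      Literature.NumberTheory.EllipticCurves.IsBDPLFunction ι' 𝔭 κ γ Dt.f ΩK Ωp L → ∀ (ΩK' : ℂ) (Ωp' : ℂ_[3]) (L'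
      : Literature.NumberTheory.EllipticCurves.UnrSeries 3), ΩK' ≠ 0 → Ωp' ≠ 0 →
      Literature.NumberTheory.EllipticCurves.IsBDPLFunction ι' 𝔭 κ γ Dt'.f ΩK' Ωp' L' → (∃ i : ℕ,
      ‖((PowerSeries.coeff i L' : Literature.NumberTheory.EllipticCurves.unrIntegers 3) : ℂ_[3])‖ = 1) → ∀ (T :
      Finset (IsDedekindDomain.HeightOneSpectrum (NumberField.RingOfIntegers K))) (c :
      IsDedekindDomain.HeightOneSpectrum (NumberField.RingOfIntegers K) → ℕ), (↑T = {v :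
      IsDedekindDomain.HeightOneSpectrum (NumberField.RingOfIntegers K) | ((3 : ℕ) : NumberField.RingOfIntegers K)
      ∉ v.asIdeal ∧ (¬ (W.baseChange K).HasGoodReductionAt v ∨ ¬ (W'.baseChange K).HasGoodReductionAt v)}) → (∀ v
      ∈ T, (∃ d₀ : Literature.NumberTheory.EllipticCurves.GreenbergSelmer.decomp (K := K) v, (κ (d₀ :
      Field.absoluteGaloisGroup K)).toAdd = (3 : ℤ_[3]) ^ c v) ∧ (∀ d :
      Literature.NumberTheory.EllipticCurves.GreenbergSelmer.decomp (K := K) v, (3 : ℤ_[3]) ^ c v ∣ (κ (d :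
      Field.absoluteGaloisGroup K)).toAdd)) →
      ∃ m m' : ℕ,
        ((∀ i < m, ‖((PowerSeries.coeff i L : unrIntegers 3) : ℂ_[3])‖ < 1) ∧
          ‖((PowerSeries.coeff m L : unrIntegers 3) : ℂ_[3])‖ = 1) ∧
        ((∀ i < m', ‖((PowerSeries.coeff i L' : unrIntegers 3) : ℂ_[3])‖ < 1) ∧
          ‖((PowerSeries.coeff m' L' : unrIntegers 3) : ℂ_[3])‖ = 1) ∧
        m + ∑ v ∈ T, 3 ^ c v * (eulerFactorModP (W.baseChange K) 3 v).rootMultiplicity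
              (((Nat.card (IsLocalRing.ResidueField (v.adicCompletionIntegers K)) : ℕ) : ZMod 3)⁻¹) ≤
          m' + ∑ v ∈ T, 3 ^ c v * (eulerFactorModP (W'.baseChange K) 3 v).rootMultiplicity
              (((Nat.card (IsLocalRing.ResidueField (v.adicCompletionIntegers K)) : ℕ) : ZMod 3)⁻¹)) :
    ∀ (W : WeierstrassCurve ℚ) [W.IsElliptic] [W.IsGloballyMinimal] (W' : WeierstrassCurve ℚ) [W'.IsElliptic]
      [W'.IsGloballyMinimal] (N N' : ℕ) [NeZero N] [NeZero N'] (K : Type) [Field K] [NumberField K]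
      (Dt : ModularParametrizationData W N) (Dt' : ModularParametrizationData W' N'),
      Additive.ClassO6 W 3 → W.HasSurjectiveModNGaloisRep 3 → W.analyticRank = 1 → W.conductorNorm ℤ = N →
      O6.ModPCongruent W' W 3 → ¬ Addv W' 3 → W'.conductorNorm ℤ = N' → IsImaginaryQuadratic K →
      SatisfiesHeegnerHypothesis N K → SatisfiesHeegnerHypothesis N' K →
      (∀ v : HeightOneSpectrum (𝓞 K), ((3 : ℕ) : 𝓞 K) ∈ v.asIdeal → Finite (selmerAcBase (W.baseChange K) 3 v ∅)) →
      ∀ (κ : ZpExtension K 3), κ.IsAnticyclotomic → ∀ (γ : absoluteGaloisGroup K) [Fact (κ.IsTopGenerator γ)]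
      (𝔭 𝔭' : HeightOneSpectrum (𝓞 K)), ((3 : ℕ) : 𝓞 K) ∈ 𝔭.asIdeal → 𝔭.asIdeal.ramificationIdx (𝓞 ℚ) = 1 →
      𝔭.asIdeal.inertiaDeg (𝓞 ℚ) = 1 → ((3 : ℕ) : 𝓞 K) ∈ 𝔭'.asIdeal → 𝔭' ≠ 𝔭 →
      ∀ (ι' : PadicAlgCl 3 ≃+* ℂ), BranchInducesPrime 3 ι' 𝔭 →
      Module.IsTorsion (IwasawaAlgebra 3) (XAc (W.baseChange K) 3 κ 𝔭' ∅ γ) →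
      (∃ g₀ : UnrSeries 3,
        (XAc.charIdeal (W.baseChange K) 3 κ 𝔭' ∅ γ).map (PowerSeries.map (Halves.toUnr 3)) = Ideal.span {g₀} ∧
          ∃ i : ℕ, ‖((PowerSeries.coeff i g₀ : unrIntegers 3) : ℂ_[3])‖ = 1) →
      ∀ (ΩK : ℂ) (Ωp : ℂ_[3]) (L : UnrSeries 3), ΩK ≠ 0 → Ωp ≠ 0 → IsBDPLFunction ι' 𝔭 κ γ Dt.f ΩK Ωp L →
      ∀ (ΩK' : ℂ) (Ωp' : ℂ_[3]) (L' : UnrSeries 3), ΩK' ≠ 0 → Ωp' ≠ 0 → IsBDPLFunction ι' 𝔭 κ γ Dt'.f ΩK' Ωp' L' →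
      (∃ i : ℕ, ‖((PowerSeries.coeff i L' : unrIntegers 3) : ℂ_[3])‖ = 1) →
      ∃ (g g' : UnrSeries 3) (n m n' m' : ℕ),
        (XAc.charIdeal (W.baseChange K) 3 κ 𝔭' ∅ γ).map (PowerSeries.map (Halves.toUnr 3)) = Ideal.span {g} ∧
        (XAc.charIdeal (W'.baseChange K) 3 κ 𝔭' ∅ γ).map (PowerSeries.map (Halves.toUnr 3)) = Ideal.span {g'} ∧
        ((∀ i < n, ‖((PowerSeries.coeff i g : unrIntegers 3) : ℂ_[3])‖ < 1) ∧
          ‖((PowerSeries.coeff n g : unrIntegers 3) : ℂ_[3])‖ = 1) ∧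
        ((∀ i < m, ‖((PowerSeries.coeff i L : unrIntegers 3) : ℂ_[3])‖ < 1) ∧
          ‖((PowerSeries.coeff m L : unrIntegers 3) : ℂ_[3])‖ = 1) ∧
        ((∀ i < n', ‖((PowerSeries.coeff i g' : unrIntegers 3) : ℂ_[3])‖ < 1) ∧
          ‖((PowerSeries.coeff n' g' : unrIntegers 3) : ℂ_[3])‖ = 1) ∧
        ((∀ i < m', ‖((PowerSeries.coeff i L' : unrIntegers 3) : ℂ_[3])‖ < 1) ∧
          ‖((PowerSeries.coeff m' L' : unrIntegers 3) : ℂ_[3])‖ = 1) ∧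
        n' + m ≤ n + m' := by
  intro W _ _ W' _ _ N N' _ _ K _ _ Dt Dt' hO6 hsurj hr hN hcong hadd hN' hK hHe hHe' hfinE κ hκ γ _ 𝔭 𝔭' h𝔭 he
    hf h𝔭' hne ι' hbr hT hμ ΩK Ωp L hΩK hΩp hL ΩK' Ωp' L' hΩK' hΩp' hL' hi'
  haveI : Fact (Nat.Prime 3) := ⟨Nat.prime_three⟩
  obtain ⟨g₀, hg₀, hi₀⟩ := hμ
  have hle₀ : Ideal.span {g₀} ≤ (XAc.charIdeal (W.baseChange K) 3 κ 𝔭' ∅ γ).map (PowerSeries.map (Halves.toUnr 3)) :=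
    hg₀ ▸ le_rfl
  -- A≤ at `(𝓛, 𝓛′)`
  have hAL := hAle W W' N N' K Dt Dt' hO6 hsurj hr hN hcong hadd hN' hK hHe hHe' κ hκ γ 𝔭 h𝔭 he hf
    𝔭' h𝔭' hne ι' hbr ΩK Ωp L hΩK hΩp hL ΩK' Ωp' L' hΩK' hΩp' hL' hi'
  -- B′≤ at `L := g₀` (the wall hypothesis of the landed one-sided transport holds trivially for the generator itself)
  obtain ⟨T, c, s, s', hTS, hdata, ⟨g, hg, hglt, hgeq⟩, -, ⟨g', hg', hglt', hgeq'⟩, hsum⟩ :=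
    oneSidedTransport (fun K _ _ ↦ SchneiderFreeAdditiveX3.PoitouTateReduction.poitouTate_selmerStructure_duality_holds K)
      poitouTateShaTateDualFact_proof W W' N N' K hO6 hsurj hr hN hcong hadd hN' hK hHe hHe' hfinE κ hκ γ 𝔭' h𝔭' hT g₀
      hle₀ hi₀
  have hTp : ∀ v ∈ T, ((3 : ℕ) : 𝓞 K) ∉ v.asIdeal := fun v hv ↦ by
    have h : v ∈ (↑T : Set (HeightOneSpectrum (𝓞 K))) := Finset.mem_coe.mpr hv
    rw [hTS] at h
    exact h.1
  -- A≤ at B′≤'s data: the norm profiles of `𝓛`, `𝓛′` and the one-sided analytic inequality `m + Σ ≤ m′ + Σ′`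
  obtain ⟨m, m', hm, hm', hle'⟩ := hAL T c hTS (fun v hv ↦ ⟨(hdata v hv).1, (hdata v hv).2.1⟩)
  have hD : ∀ v ∈ T, ¬ (decomp v ≤ κ.kerSubgroup) := by
    intro v hv hle
    obtain ⟨⟨d₀, hd₀⟩, -⟩ := hdata v hv
    have h1 : κ (d₀ : absoluteGaloisGroup K) = 1 := (ZpExtension.mem_kerSubgroup).mp (hle d₀.2)
    rw [h1, toAdd_one] at hd₀
    exact pow_ne_zero (c v) (by norm_num : (3 : ℤ_[3]) ≠ 0) hd₀.symm
  have hloc : ∀ v ∈ T,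
      (eulerFactorModP (W.baseChange K) 3 v).rootMultiplicity
          (((Nat.card (IsLocalRing.ResidueField (v.adicCompletionIntegers K)) : ℕ) : ZMod 3)⁻¹) = s v ∧
        (eulerFactorModP (W'.baseChange K) 3 v).rootMultiplicity
          (((Nat.card (IsLocalRing.ResidueField (v.adicCompletionIntegers K)) : ℕ) : ZMod 3)⁻¹) = s' v := by
    intro v hv
    obtain ⟨-, -, hs, hs'⟩ := hdata v hv
    rw [natCard_pTorsion_subgroupH1_kerD_eq_pow_rootMultiplicity (W.baseChange K) v κ (hTp v hv) (hD v hv)]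
      at hs
    rw [natCard_pTorsion_subgroupH1_kerD_eq_pow_rootMultiplicity (W'.baseChange K) v κ (hTp v hv) (hD v hv)]
      at hs'
    have h3 : Function.Injective (fun k : ℕ ↦ 3 ^ k) := Nat.pow_right_injective (by norm_num)
    exact ⟨h3 hs, h3 hs'⟩
  have hS₁ : ∑ v ∈ T, 3 ^ c v * (eulerFactorModP (W.baseChange K) 3 v).rootMultiplicity
        (((Nat.card (IsLocalRing.ResidueField (v.adicCompletionIntegers K)) : ℕ) : ZMod 3)⁻¹) =
      ∑ v ∈ T, 3 ^ c v * s v :=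
    Finset.sum_congr rfl fun v hv ↦ by rw [(hloc v hv).1]
  have hS₂ : ∑ v ∈ T, 3 ^ c v * (eulerFactorModP (W'.baseChange K) 3 v).rootMultiplicity
        (((Nat.card (IsLocalRing.ResidueField (v.adicCompletionIntegers K)) : ℕ) : ZMod 3)⁻¹) =
      ∑ v ∈ T, 3 ^ c v * s' v :=
    Finset.sum_congr rfl fun v hv ↦ by rw [(hloc v hv).2]
  rw [hS₁, hS₂] at hle'
  exact ⟨g, g', _, m, _, m', hg, hg', ⟨hglt, hgeq⟩, hm, ⟨hglt', hgeq'⟩, hm', by omega⟩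

/-- **♭T≤ without the wall, keyed on A≤**: ♭T≤'s conclusion from A≤, the twin's `Λ`-torsion and a `μ = 0` generator of
`Ch_Λ(X_{∅,0}(E′/K_∞))·R₀⟦T⟧` (torsion and `μ = 0` move to `E` by `torsionMuTransportModThree`, GV Prop. 2.8 along `E[3] ≅ E′[3]`).
[cite: GreenbergVatsal2000, Thm. (1.4), §2 Prop. (2.8)] [cite: LeiMullerXia2023, Thm. 5.1] -/
theorem defectTransportPT_wallFree_of_lambdaLe
    (hAle :
      ∀ (W : WeierstrassCurve ℚ) [W.IsElliptic] [W.IsGloballyMinimal] (W' : WeierstrassCurve ℚ) [W'.IsElliptic]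
      [W'.IsGloballyMinimal] (N N' : ℕ) [NeZero N] [NeZero N'] (K : Type) [Field K] [NumberField K] (Dt :
      Literature.NumberTheory.EllipticCurves.ModularForms.ModularParametrizationData W N) (Dt' :
      Literature.NumberTheory.EllipticCurves.ModularForms.ModularParametrizationData W' N'),
      Summit.BirchSwinnertonDyer.Rank1Residual.Additive.ClassO6 W 3 → W.HasSurjectiveModNGaloisRep 3 →
      W.analyticRank = 1 → W.conductorNorm ℤ = N → Summit.BirchSwinnertonDyer.Rank1Residual.O6.ModPCongruent W' W
      3 → ¬ Literature.NumberTheory.EllipticCurves.Rank1Residual.Addv W' 3 → W'.conductorNorm ℤ = N' →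
      Literature.NumberTheory.EllipticCurves.IsImaginaryQuadratic K →
      Literature.NumberTheory.EllipticCurves.SatisfiesHeegnerHypothesis N K →
      Literature.NumberTheory.EllipticCurves.SatisfiesHeegnerHypothesis N' K → ∀ (κ :
      Literature.NumberTheory.EllipticCurves.ZpExtension K 3), κ.IsAnticyclotomic → ∀ (γ :
      Field.absoluteGaloisGroup K) [Fact (κ.IsTopGenerator γ)] (𝔭 : IsDedekindDomain.HeightOneSpectrum
      (NumberField.RingOfIntegers K)), ((3 : ℕ) : NumberField.RingOfIntegers K) ∈ 𝔭.asIdeal →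
      𝔭.asIdeal.ramificationIdx (NumberField.RingOfIntegers ℚ) = 1 → 𝔭.asIdeal.inertiaDeg
      (NumberField.RingOfIntegers ℚ) = 1 → ∀ (𝔭' : IsDedekindDomain.HeightOneSpectrum (NumberField.RingOfIntegers
      K)), ((3 : ℕ) : NumberField.RingOfIntegers K) ∈ 𝔭'.asIdeal → 𝔭' ≠ 𝔭 → ∀ (ι' : PadicAlgCl 3 ≃+* ℂ),
      Summit.BirchSwinnertonDyer.BirchSwinnertonDyer.Theorems.SchneiderFree.BranchInducesPrime 3 ι' 𝔭 → ∀ (ΩK : ℂ)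
      (Ωp : ℂ_[3]) (L : Literature.NumberTheory.EllipticCurves.UnrSeries 3), ΩK ≠ 0 → Ωp ≠ 0 →
      Literature.NumberTheory.EllipticCurves.IsBDPLFunction ι' 𝔭 κ γ Dt.f ΩK Ωp L → ∀ (ΩK' : ℂ) (Ωp' : ℂ_[3]) (L'
      : Literature.NumberTheory.EllipticCurves.UnrSeries 3), ΩK' ≠ 0 → Ωp' ≠ 0 →
      Literature.NumberTheory.EllipticCurves.IsBDPLFunction ι' 𝔭 κ γ Dt'.f ΩK' Ωp' L' → (∃ i : ℕ,
      ‖((PowerSeries.coeff i L' : Literature.NumberTheory.EllipticCurves.unrIntegers 3) : ℂ_[3])‖ = 1) → ∀ (T :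
      Finset (IsDedekindDomain.HeightOneSpectrum (NumberField.RingOfIntegers K))) (c :
      IsDedekindDomain.HeightOneSpectrum (NumberField.RingOfIntegers K) → ℕ), (↑T = {v :
      IsDedekindDomain.HeightOneSpectrum (NumberField.RingOfIntegers K) | ((3 : ℕ) : NumberField.RingOfIntegers K)
      ∉ v.asIdeal ∧ (¬ (W.baseChange K).HasGoodReductionAt v ∨ ¬ (W'.baseChange K).HasGoodReductionAt v)}) → (∀ v
      ∈ T, (∃ d₀ : Literature.NumberTheory.EllipticCurves.GreenbergSelmer.decomp (K := K) v, (κ (d₀ :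
      Field.absoluteGaloisGroup K)).toAdd = (3 : ℤ_[3]) ^ c v) ∧ (∀ d :
      Literature.NumberTheory.EllipticCurves.GreenbergSelmer.decomp (K := K) v, (3 : ℤ_[3]) ^ c v ∣ (κ (d :
      Field.absoluteGaloisGroup K)).toAdd)) →
      ∃ m m' : ℕ,
        ((∀ i < m, ‖((PowerSeries.coeff i L : unrIntegers 3) : ℂ_[3])‖ < 1) ∧
          ‖((PowerSeries.coeff m L : unrIntegers 3) : ℂ_[3])‖ = 1) ∧
        ((∀ i < m', ‖((PowerSeries.coeff i L' : unrIntegers 3) : ℂ_[3])‖ < 1) ∧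
          ‖((PowerSeries.coeff m' L' : unrIntegers 3) : ℂ_[3])‖ = 1) ∧
        m + ∑ v ∈ T, 3 ^ c v * (eulerFactorModP (W.baseChange K) 3 v).rootMultiplicity
              (((Nat.card (IsLocalRing.ResidueField (v.adicCompletionIntegers K)) : ℕ) : ZMod 3)⁻¹) ≤
          m' + ∑ v ∈ T, 3 ^ c v * (eulerFactorModP (W'.baseChange K) 3 v).rootMultiplicity
              (((Nat.card (IsLocalRing.ResidueField (v.adicCompletionIntegers K)) : ℕ) : ZMod 3)⁻¹)) :
    ∀ (W : WeierstrassCurve ℚ) [W.IsElliptic] [W.IsGloballyMinimal] (W' : WeierstrassCurve ℚ) [W'.IsElliptic]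
      [W'.IsGloballyMinimal] (N N' : ℕ) [NeZero N] [NeZero N'] (K : Type) [Field K] [NumberField K]
      (Dt : ModularParametrizationData W N) (Dt' : ModularParametrizationData W' N'),
      Additive.ClassO6 W 3 → W.HasSurjectiveModNGaloisRep 3 → W.analyticRank = 1 → W.conductorNorm ℤ = N →
      O6.ModPCongruent W' W 3 → ¬ Addv W' 3 → W'.conductorNorm ℤ = N' → IsImaginaryQuadratic K →
      SatisfiesHeegnerHypothesis N K → SatisfiesHeegnerHypothesis N' K →
      (∀ v : HeightOneSpectrum (𝓞 K), ((3 : ℕ) : 𝓞 K) ∈ v.asIdeal → Finite (selmerAcBase (W.baseChange K) 3 v ∅)) →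
      ∀ (κ : ZpExtension K 3), κ.IsAnticyclotomic → ∀ (γ : absoluteGaloisGroup K) [Fact (κ.IsTopGenerator γ)]
      (𝔭 𝔭' : HeightOneSpectrum (𝓞 K)), ((3 : ℕ) : 𝓞 K) ∈ 𝔭.asIdeal → 𝔭.asIdeal.ramificationIdx (𝓞 ℚ) = 1 →
      𝔭.asIdeal.inertiaDeg (𝓞 ℚ) = 1 → ((3 : ℕ) : 𝓞 K) ∈ 𝔭'.asIdeal → 𝔭' ≠ 𝔭 →
      ∀ (ι' : PadicAlgCl 3 ≃+* ℂ), BranchInducesPrime 3 ι' 𝔭 →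
      Module.IsTorsion (IwasawaAlgebra 3) (XAc (W'.baseChange K) 3 κ 𝔭' ∅ γ) →
      (∃ g'₀ : UnrSeries 3,
        (XAc.charIdeal (W'.baseChange K) 3 κ 𝔭' ∅ γ).map (PowerSeries.map (Halves.toUnr 3)) = Ideal.span {g'₀} ∧
          ∃ i : ℕ, ‖((PowerSeries.coeff i g'₀ : unrIntegers 3) : ℂ_[3])‖ = 1) →
      ∀ (ΩK : ℂ) (Ωp : ℂ_[3]) (L : UnrSeries 3), ΩK ≠ 0 → Ωp ≠ 0 → IsBDPLFunction ι' 𝔭 κ γ Dt.f ΩK Ωp L →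
      ∀ (ΩK' : ℂ) (Ωp' : ℂ_[3]) (L' : UnrSeries 3), ΩK' ≠ 0 → Ωp' ≠ 0 → IsBDPLFunction ι' 𝔭 κ γ Dt'.f ΩK' Ωp' L' →
      (∃ i : ℕ, ‖((PowerSeries.coeff i L' : unrIntegers 3) : ℂ_[3])‖ = 1) →
      ∃ (g g' : UnrSeries 3) (n m n' m' : ℕ),
        (XAc.charIdeal (W.baseChange K) 3 κ 𝔭' ∅ γ).map (PowerSeries.map (Halves.toUnr 3)) = Ideal.span {g} ∧
        (XAc.charIdeal (W'.baseChange K) 3 κ 𝔭' ∅ γ).map (PowerSeries.map (Halves.toUnr 3)) = Ideal.span {g'} ∧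
        ((∀ i < n, ‖((PowerSeries.coeff i g : unrIntegers 3) : ℂ_[3])‖ < 1) ∧
          ‖((PowerSeries.coeff n g : unrIntegers 3) : ℂ_[3])‖ = 1) ∧
        ((∀ i < m, ‖((PowerSeries.coeff i L : unrIntegers 3) : ℂ_[3])‖ < 1) ∧
          ‖((PowerSeries.coeff m L : unrIntegers 3) : ℂ_[3])‖ = 1) ∧
        ((∀ i < n', ‖((PowerSeries.coeff i g' : unrIntegers 3) : ℂ_[3])‖ < 1) ∧
          ‖((PowerSeries.coeff n' g' : unrIntegers 3) : ℂ_[3])‖ = 1) ∧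
        ((∀ i < m', ‖((PowerSeries.coeff i L' : unrIntegers 3) : ℂ_[3])‖ < 1) ∧
          ‖((PowerSeries.coeff m' L' : unrIntegers 3) : ℂ_[3])‖ = 1) ∧
        n' + m ≤ n + m' := by
  intro W _ _ W' _ _ N N' _ _ K _ _ Dt Dt' hO6 hsurj hr hN hcong hadd hN' hK hHe hHe' hfinE κ hκ γ _ 𝔭 𝔭' h𝔭 he
    hf h𝔭' hne ι' hbr hT' hμ' ΩK Ωp L hΩK hΩp hL ΩK' Ωp' L' hΩK' hΩp' hL' hi'
  obtain ⟨hT, hμ⟩ :=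
    UniversalToricDescentTorsionMuTransportHeegner.torsionMuTransportModThree W W' K hN hcong hN' hK hHe hHe' κ hκ γ 𝔭'
      h𝔭' hT' hμ'
  exact defectTransportPT_of_mu_of_lambdaLe hAle W W' N N' K Dt Dt' hO6 hsurj hr hN hcong hadd hN' hK
    hHe hHe' hfinE κ hκ γ 𝔭 𝔭' h𝔭 he hf h𝔭' hne ι' hbr hT hμ ΩK Ωp L hΩK hΩp hL ΩK' Ωp' L' hΩK' hΩp' hL' hi'

/-- **♭T≤ without the wall, keyed on A≤, twin input in main-conjecture form** `Ch_Λ(X_{∅,0}(E′/K_∞))·R₀⟦T⟧ = (𝓛′)` at the frame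
`𝓛′` (whose `μ = 0` is a binder). [cite: GreenbergVatsal2000, Thm. (1.4), §2 Prop. (2.8)] -/
theorem defectTransportPT_wallFree_of_lambdaLe_of_twinIMC
    (hAle :
      ∀ (W : WeierstrassCurve ℚ) [W.IsElliptic] [W.IsGloballyMinimal] (W' : WeierstrassCurve ℚ) [W'.IsElliptic]
      [W'.IsGloballyMinimal] (N N' : ℕ) [NeZero N] [NeZero N'] (K : Type) [Field K] [NumberField K] (Dt :
      Literature.NumberTheory.EllipticCurves.ModularForms.ModularParametrizationData W N) (Dt' :
      Literature.NumberTheory.EllipticCurves.ModularForms.ModularParametrizationData W' N'),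
      Summit.BirchSwinnertonDyer.Rank1Residual.Additive.ClassO6 W 3 → W.HasSurjectiveModNGaloisRep 3 →
      W.analyticRank = 1 → W.conductorNorm ℤ = N → Summit.BirchSwinnertonDyer.Rank1Residual.O6.ModPCongruent W' W
      3 → ¬ Literature.NumberTheory.EllipticCurves.Rank1Residual.Addv W' 3 → W'.conductorNorm ℤ = N' →
      Literature.NumberTheory.EllipticCurves.IsImaginaryQuadratic K →
      Literature.NumberTheory.EllipticCurves.SatisfiesHeegnerHypothesis N K →
      Literature.NumberTheory.EllipticCurves.SatisfiesHeegnerHypothesis N' K → ∀ (κ :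
      Literature.NumberTheory.EllipticCurves.ZpExtension K 3), κ.IsAnticyclotomic → ∀ (γ :
      Field.absoluteGaloisGroup K) [Fact (κ.IsTopGenerator γ)] (𝔭 : IsDedekindDomain.HeightOneSpectrum
      (NumberField.RingOfIntegers K)), ((3 : ℕ) : NumberField.RingOfIntegers K) ∈ 𝔭.asIdeal →
      𝔭.asIdeal.ramificationIdx (NumberField.RingOfIntegers ℚ) = 1 → 𝔭.asIdeal.inertiaDeg
      (NumberField.RingOfIntegers ℚ) = 1 → ∀ (𝔭' : IsDedekindDomain.HeightOneSpectrum (NumberField.RingOfIntegers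
      K)), ((3 : ℕ) : NumberField.RingOfIntegers K) ∈ 𝔭'.asIdeal → 𝔭' ≠ 𝔭 → ∀ (ι' : PadicAlgCl 3 ≃+* ℂ),
      Summit.BirchSwinnertonDyer.BirchSwinnertonDyer.Theorems.SchneiderFree.BranchInducesPrime 3 ι' 𝔭 → ∀ (ΩK : ℂ)
      (Ωp : ℂ_[3]) (L : Literature.NumberTheory.EllipticCurves.UnrSeries 3), ΩK ≠ 0 → Ωp ≠ 0 →
      Literature.NumberTheory.EllipticCurves.IsBDPLFunction ι' 𝔭 κ γ Dt.f ΩK Ωp L → ∀ (ΩK' : ℂ) (Ωp' : ℂ_[3]) (L'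
      : Literature.NumberTheory.EllipticCurves.UnrSeries 3), ΩK' ≠ 0 → Ωp' ≠ 0 →
      Literature.NumberTheory.EllipticCurves.IsBDPLFunction ι' 𝔭 κ γ Dt'.f ΩK' Ωp' L' → (∃ i : ℕ,
      ‖((PowerSeries.coeff i L' : Literature.NumberTheory.EllipticCurves.unrIntegers 3) : ℂ_[3])‖ = 1) → ∀ (T :
      Finset (IsDedekindDomain.HeightOneSpectrum (NumberField.RingOfIntegers K))) (c :
      IsDedekindDomain.HeightOneSpectrum (NumberField.RingOfIntegers K) → ℕ), (↑T = {v :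
      IsDedekindDomain.HeightOneSpectrum (NumberField.RingOfIntegers K) | ((3 : ℕ) : NumberField.RingOfIntegers K)
      ∉ v.asIdeal ∧ (¬ (W.baseChange K).HasGoodReductionAt v ∨ ¬ (W'.baseChange K).HasGoodReductionAt v)}) → (∀ v
      ∈ T, (∃ d₀ : Literature.NumberTheory.EllipticCurves.GreenbergSelmer.decomp (K := K) v, (κ (d₀ :
      Field.absoluteGaloisGroup K)).toAdd = (3 : ℤ_[3]) ^ c v) ∧ (∀ d :
      Literature.NumberTheory.EllipticCurves.GreenbergSelmer.decomp (K := K) v, (3 : ℤ_[3]) ^ c v ∣ (κ (d :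
      Field.absoluteGaloisGroup K)).toAdd)) →
      ∃ m m' : ℕ,
        ((∀ i < m, ‖((PowerSeries.coeff i L : unrIntegers 3) : ℂ_[3])‖ < 1) ∧
          ‖((PowerSeries.coeff m L : unrIntegers 3) : ℂ_[3])‖ = 1) ∧
        ((∀ i < m', ‖((PowerSeries.coeff i L' : unrIntegers 3) : ℂ_[3])‖ < 1) ∧
          ‖((PowerSeries.coeff m' L' : unrIntegers 3) : ℂ_[3])‖ = 1) ∧
        m + ∑ v ∈ T, 3 ^ c v * (eulerFactorModP (W.baseChange K) 3 v).rootMultiplicity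
              (((Nat.card (IsLocalRing.ResidueField (v.adicCompletionIntegers K)) : ℕ) : ZMod 3)⁻¹) ≤
          m' + ∑ v ∈ T, 3 ^ c v * (eulerFactorModP (W'.baseChange K) 3 v).rootMultiplicity
              (((Nat.card (IsLocalRing.ResidueField (v.adicCompletionIntegers K)) : ℕ) : ZMod 3)⁻¹)) :
    ∀ (W : WeierstrassCurve ℚ) [W.IsElliptic] [W.IsGloballyMinimal] (W' : WeierstrassCurve ℚ) [W'.IsElliptic]
      [W'.IsGloballyMinimal] (N N' : ℕ) [NeZero N] [NeZero N'] (K : Type) [Field K] [NumberField K]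
      (Dt : ModularParametrizationData W N) (Dt' : ModularParametrizationData W' N'),
      Additive.ClassO6 W 3 → W.HasSurjectiveModNGaloisRep 3 → W.analyticRank = 1 → W.conductorNorm ℤ = N →
      O6.ModPCongruent W' W 3 → ¬ Addv W' 3 → W'.conductorNorm ℤ = N' → IsImaginaryQuadratic K →
      SatisfiesHeegnerHypothesis N K → SatisfiesHeegnerHypothesis N' K →
      (∀ v : HeightOneSpectrum (𝓞 K), ((3 : ℕ) : 𝓞 K) ∈ v.asIdeal → Finite (selmerAcBase (W.baseChange K) 3 v ∅)) →
      ∀ (κ : ZpExtension K 3), κ.IsAnticyclotomic → ∀ (γ : absoluteGaloisGroup K) [Fact (κ.IsTopGenerator γ)]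
      (𝔭 𝔭' : HeightOneSpectrum (𝓞 K)), ((3 : ℕ) : 𝓞 K) ∈ 𝔭.asIdeal → 𝔭.asIdeal.ramificationIdx (𝓞 ℚ) = 1 →
      𝔭.asIdeal.inertiaDeg (𝓞 ℚ) = 1 → ((3 : ℕ) : 𝓞 K) ∈ 𝔭'.asIdeal → 𝔭' ≠ 𝔭 →
      ∀ (ι' : PadicAlgCl 3 ≃+* ℂ), BranchInducesPrime 3 ι' 𝔭 →
      Module.IsTorsion (IwasawaAlgebra 3) (XAc (W'.baseChange K) 3 κ 𝔭' ∅ γ) →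
      ∀ (ΩK : ℂ) (Ωp : ℂ_[3]) (L : UnrSeries 3), ΩK ≠ 0 → Ωp ≠ 0 → IsBDPLFunction ι' 𝔭 κ γ Dt.f ΩK Ωp L →
      ∀ (ΩK' : ℂ) (Ωp' : ℂ_[3]) (L' : UnrSeries 3), ΩK' ≠ 0 → Ωp' ≠ 0 → IsBDPLFunction ι' 𝔭 κ γ Dt'.f ΩK' Ωp' L' →
      (XAc.charIdeal (W'.baseChange K) 3 κ 𝔭' ∅ γ).map (PowerSeries.map (Halves.toUnr 3)) = Ideal.span {L'} →
      (∃ i : ℕ, ‖((PowerSeries.coeff i L' : unrIntegers 3) : ℂ_[3])‖ = 1) →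
      ∃ (g g' : UnrSeries 3) (n m n' m' : ℕ),
        (XAc.charIdeal (W.baseChange K) 3 κ 𝔭' ∅ γ).map (PowerSeries.map (Halves.toUnr 3)) = Ideal.span {g} ∧
        (XAc.charIdeal (W'.baseChange K) 3 κ 𝔭' ∅ γ).map (PowerSeries.map (Halves.toUnr 3)) = Ideal.span {g'} ∧
        ((∀ i < n, ‖((PowerSeries.coeff i g : unrIntegers 3) : ℂ_[3])‖ < 1) ∧
          ‖((PowerSeries.coeff n g : unrIntegers 3) : ℂ_[3])‖ = 1) ∧
        ((∀ i < m, ‖((PowerSeries.coeff i L : unrIntegers 3) : ℂ_[3])‖ < 1) ∧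
          ‖((PowerSeries.coeff m L : unrIntegers 3) : ℂ_[3])‖ = 1) ∧
        ((∀ i < n', ‖((PowerSeries.coeff i g' : unrIntegers 3) : ℂ_[3])‖ < 1) ∧
          ‖((PowerSeries.coeff n' g' : unrIntegers 3) : ℂ_[3])‖ = 1) ∧
        ((∀ i < m', ‖((PowerSeries.coeff i L' : unrIntegers 3) : ℂ_[3])‖ < 1) ∧
          ‖((PowerSeries.coeff m' L' : unrIntegers 3) : ℂ_[3])‖ = 1) ∧
        n' + m ≤ n + m' := by
  intro W _ _ W' _ _ N N' _ _ K _ _ Dt Dt' hO6 hsurj hr hN hcong hadd hN' hK hHe hHe' hfinE κ hκ γ _ 𝔭 𝔭' h𝔭 he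
    hf h𝔭' hne ι' hbr hT' ΩK Ωp L hΩK hΩp hL ΩK' Ωp' L' hΩK' hΩp' hL' heq' hi'
  exact defectTransportPT_wallFree_of_lambdaLe hAle W W' N N' K Dt Dt' hO6 hsurj hr hN hcong hadd hN' hK
    hHe hHe' hfinE κ hκ γ 𝔭 𝔭' h𝔭 he hf h𝔭' hne ι' hbr hT' ⟨L', heq', hi'⟩ ΩK Ωp L hΩK hΩp hL ΩK' Ωp' L' hΩK' hΩp' hL'
    hi'

end Summit.BirchSwinnertonDyer.BirchSwinnertonDyer.Theorems.UniversalToricDescentDefectTransportModThreePTWallFreeOfLambdaLe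

end
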